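import Summits.FinalStateConjecture.FinalStateConjecture.Theorems.PhotonSphereChannelsChannelsResolveTameDevelopmentsRNoExtremalShadow
import HarnessLib

/-!
# Route PhotonSphereChannels · crux `ChannelsResolveTameDevelopmentsR` (K2R-T2, stmt-FinalStateConjecture-17430) ·
# line `tame-lasalle-dock` · stub N `stub_noExtremalShadow`: the promotion DECOMPOSED — rebasing of outer extremal
# shadows, extremal pinning along the generator, late-chart gluing along an extremal generator — and N at every class
# carrying a precompact generator hull

Sequel of `…RNoExtremalShadow.lean`, where N was re-typed as "every silent hull element of a development as in Φ is
late-charted" (`LateChartFromHullElement`, equivalent to N). Here the promotion is cut into the three inputs its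
intended proof consumes, each a predicate on ONE development and ONE class (and one generator path), so that the lead
can staff them separately and see which neighbour already carries which part:

* (E1) `ExtremalOuterRebase 𝒟 Λ r₀` — an OUTER silent hull element whose d.o.c. carries an isometric copy of an
  extremal smooth Kerr exterior of mass `M'` is SHADOWED ON THE HORIZON: along some horizon generator path `γ` and
  divergent parameter sequence there is a horizon-hull element `(𝓢', E', p')` of the class — possibly a different end:
  the outer element may be a horizonless trimming, or the extremal white-hole patch of `Negative/EmptyHorizonEnd`, or
  the bare extremal exterior with a throat-adapted clock, none of which is itself horizon-based — whose d.o.c. again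
  carries an isometric copy of an extremal exterior of mass `M'` (the shadowing clause (c) of A′, `OuterHullShadowed` /
  `HorizonThreading`, in the extremal-shadow form; content: an extremal-shadowed outer limit of a development as in Φ
  sees the development's event horizon at bounded distance);
* (E2) `ExtremalPinningAlong 𝒟 Λ r₀ γ` — ONE horizon-hull element along `γ` with an extremal shadow of mass `M'` makes
  EVERY horizon-hull element along `γ` extremal-shadowed with the same mass (spin `±M'`): the extremal case of K♭'s
  unique pinning (UP), intended from the two monotone budgets (horizon area along `γ`, mass) once every element along
  `γ` is classified (SEK through dock-ready representatives returns `|a| ≤ M'` BEFORE N is known);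
* (E3) `LateChartOfExtremalGenerator 𝒟 Λ r₀ γ` — if horizon-hull elements exist along EVERY divergent parameter
  sequence of `γ` (precompactness of the generator hull along `γ`, clause (b) of A′) and ALL of them are
  extremal-shadowed with mass `M'`, then `𝒟` carries a late chart from a boosted extremal Kerr background of mass `M'`
  with near-zone `C²` deviation `→ 0` on every truncated slab (the extremal, one-generator case of T′'s hole-chart
  producer (M2): glue the comparison maps of consecutive windows along `γ`, whose transition maps are `C²`-close to
  isometries of the stationary axisymmetric limit; no far honesty is needed — `IsLateChart … univ` measures the deviation
  on `{r ≤ R}` only, so the radial range beyond the honest radius is absorbed by a reparametrisation).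

Proved here (logic only): (E2) ∧ (E3) + precompactness along `γ` ⇒ every horizon-hull element along `γ` is late-charted
(`lateChartFromHullElement_of_pinning_of_gluing`); with (E1) also every outer silent hull element of the class
(`lateChartFromHullElement_of_rebase`); hence N AT EVERY CLASS WITH `0 < r₀` AND A PRECOMPACT GENERATOR HULL
(`GeneratorHullExists 𝒟 Λ r₀`) — the text of N with these two hypotheses inserted, which is all the line's composition
consumes (A′ supplies both at its class) — from (i) and the three inputs
(`noExtremalShadow_ofClass_of_rebase_of_pinning_of_gluing`, registered sub-goal). N for ALL classes would need (E3)
without its precompactness hypothesis, a less plausible input; the worker report recommends weakening N (and R, D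
alongside) to A′'s class.

References: M. Dafermos, J. Luk, arXiv:1710.01722, §1.2.1 [DafermosLuk2017]; DHRT arXiv:2104.08222, §1 [arXiv210408222];
P. T. Chruściel, E. Delay, G. Galloway, R. Howard, AHP 2 (2001), Thm 1.1 (area theorem) [ChruscielEtAl2001]; J. Hale,
*Ordinary Differential Equations* (1980), Ch. I §8 (ω-limit sets) [Hale1980].
-/

noncomputable section

-- the operator-norm instance on `E4 →L[ℝ] E4 →L[ℝ] ℝ` needs one more level of pending
-- instance problems than the default (as in `PhotonSphereChannelsTameHullDefs.lean`)
set_option maxSynthPendingDepth 3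
-- every `Summit.FinalStateConjecture.FinalStateConjecture.…` name repeats the summit = sub-problem segment (D-0017 layout)
set_option linter.dupNamespace false

open Set Filter Function TopologicalSpace Manifold Bundle
open scoped Topology Manifold ContDiff ENNReal NNReal

namespace Summit.FinalStateConjecture.FinalStateConjecture.Theorems.TameLaSalle

open Literature.Geometry.Lorentzian
open Summit.FinalStateConjecture.FinalStateConjecture.Theorems.TameHull
open Summit.FinalStateConjecture.FinalStateConjecture.Theorems.DarkFuture

section Development

variable {X : Type} [TopologicalSpace X] [ChartedSpace E3 X] [IsManifold (𝓡 3) ∞ X] [ConnectedSpace X]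
  {D : InitialDataSet (𝓡 3) X}

/-! ### §1 The three inputs of the promotion -/

/-- **(E1) `ExtremalOuterRebase 𝒟 Λ r₀` — outer extremal shadows are shadowed on the horizon.** For every OUTER silent
hull element `(𝓢, E, p)` of the class `(Λ, r₀)` whose domain of outer communications `E.doc` is the image of an
injective local isometry of an EXTREMAL smooth Kerr exterior of mass `M'`, there are a horizon generator path `γ`, a
divergent parameter sequence `s` and a horizon-hull element `(𝓢', E', p')` of the class along `γ ∘ s` whose d.o.c. is
again the image of an injective local isometry of an extremal smooth Kerr exterior of mass `M'` (spin `a'`,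
`Kerr.IsExtremal M' a'`). The end may change: a horizonless trimming of an element, the extremal white-hole patch or
the bare extremal exterior with a throat-adapted clock are outer candidates that are not themselves horizon-based, so
asking for the SAME end would only be provable by refuting such elements outright. Shadowing (clause (c) of A′) in
extremal-shadow form; so that pinning (E2) and gluing (E3) along `γ` apply. [cite: DafermosLuk2017, §1.2.1] -/
def ExtremalOuterRebase (𝒟 : VacuumCauchyDevelopment D) [𝒟.metric.HasLeviCivita] (Λ : ℕ → ℝ≥0) (r₀ : ℝ) : Prop :=
  ∀ (q : ℕ → 𝒟.carrier) (𝓢 : Spacetime.{0} 4) (E : EndDatum 𝓢) (p : 𝓢.carrier), IsSilentHullElement 𝒟 Λ r₀ q 𝓢 E p →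
    ∀ [Kerr.Facts], ∀ M' a : ℝ, Kerr.IsExtremal M' a →
      (∃ Ψ : Kerr.exterior M' a → 𝓢.carrier, Function.Injective Ψ ∧ Set.range Ψ = E.doc ∧
        PseudoRiemannianMetric.IsLocalIsometry
          (Kerr.smoothMetric M' a (Kerr.rPlus M' a)).toPseudoRiemannianMetric
          𝓢.metric.toPseudoRiemannianMetric Ψ) →
      ∃ (γ : ℝ → 𝒟.carrier) (s : ℕ → ℝ) (𝓢' : Spacetime.{0} 4) (E' : EndDatum 𝓢') (p' : 𝓢'.carrier) (a' : ℝ),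
        IsHorizonPath 𝒟 γ ∧ Tendsto s atTop atTop ∧ IsHorizonHullElementAlong 𝒟 Λ r₀ γ s 𝓢' E' p' ∧
        Kerr.IsExtremal M' a' ∧
          ∃ Ψ' : Kerr.exterior M' a' → 𝓢'.carrier, Function.Injective Ψ' ∧ Set.range Ψ' = E'.doc ∧
            PseudoRiemannianMetric.IsLocalIsometry
              (Kerr.smoothMetric M' a' (Kerr.rPlus M' a')).toPseudoRiemannianMetric
              𝓢'.metric.toPseudoRiemannianMetric Ψ'

/-- **(E2) `ExtremalPinningAlong 𝒟 Λ r₀ γ` — extremal pinning along the generator.** If SOME horizon-hull element along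
`γ` has d.o.c. carrying an injective local isometry of an extremal smooth Kerr exterior of mass `M'`, then EVERY
horizon-hull element along `γ` has d.o.c. carrying such a copy of an extremal exterior of the same mass (spin `a'`,
`Kerr.IsExtremal M' a'`, i.e. `a' = ±M'`). The extremal case of K♭'s unique pinning: the horizon area is monotone along
`γ` hence constant on limits, so is the mass; for Kerr-classified elements the two determine `(M, |a|)`.
[cite: ChruscielEtAl2001, Thm 1.1] -/
def ExtremalPinningAlong (𝒟 : VacuumCauchyDevelopment D) [𝒟.metric.HasLeviCivita] (Λ : ℕ → ℝ≥0) (r₀ : ℝ)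
    (γ : ℝ → 𝒟.carrier) : Prop :=
  ∀ [Kerr.Facts], ∀ M' a : ℝ, Kerr.IsExtremal M' a →
    (∃ (𝓢 : Spacetime.{0} 4) (E : EndDatum 𝓢) (p : 𝓢.carrier), IsHorizonHullElement 𝒟 Λ r₀ γ 𝓢 E p ∧
      ∃ Ψ : Kerr.exterior M' a → 𝓢.carrier, Function.Injective Ψ ∧ Set.range Ψ = E.doc ∧
        PseudoRiemannianMetric.IsLocalIsometry
          (Kerr.smoothMetric M' a (Kerr.rPlus M' a)).toPseudoRiemannianMetric
          𝓢.metric.toPseudoRiemannianMetric Ψ) →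
    ∀ (𝓢 : Spacetime.{0} 4) (E : EndDatum 𝓢) (p : 𝓢.carrier), IsHorizonHullElement 𝒟 Λ r₀ γ 𝓢 E p →
      ∃ a' : ℝ, Kerr.IsExtremal M' a' ∧
        ∃ Ψ : Kerr.exterior M' a' → 𝓢.carrier, Function.Injective Ψ ∧ Set.range Ψ = E.doc ∧
          PseudoRiemannianMetric.IsLocalIsometry
            (Kerr.smoothMetric M' a' (Kerr.rPlus M' a')).toPseudoRiemannianMetric
            𝓢.metric.toPseudoRiemannianMetric Ψ

/-- **(E3) `LateChartOfExtremalGenerator 𝒟 Λ r₀ γ` — late-chart gluing along an extremal generator.** If horizon-hull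
elements of the class exist along EVERY divergent parameter sequence of `γ` (precompactness of the generator hull along
`γ`) and EVERY horizon-hull element along `γ` has d.o.c. carrying an injective local isometry of an extremal smooth Kerr
exterior of mass `M'`, then the development carries a late-time chart from a boosted extremal Kerr background
`(Λ, c, M', a)`, `Kerr.IsExtremal M' a`, into `univ` after some `τ₀`, with near-zone `C²` deviation tending to `0` on
every truncated slab `{t* = τ, r ≤ R}` — the witness shape of `¬ NoExtremalRemnant 𝒟`. The extremal one-generator case
of T′'s hole-chart producer. [cite: arXiv210408222, §1] -/
def LateChartOfExtremalGenerator (𝒟 : VacuumCauchyDevelopment D) [𝒟.metric.HasLeviCivita] (Λ : ℕ → ℝ≥0) (r₀ : ℝ)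
    (γ : ℝ → 𝒟.carrier) : Prop :=
  ∀ [Kerr.Facts], ∀ M' : ℝ, 0 < M' →
    (∀ s : ℕ → ℝ, Tendsto s atTop atTop →
      ∃ (𝓢 : Spacetime.{0} 4) (E : EndDatum 𝓢) (p : 𝓢.carrier), IsHorizonHullElementAlong 𝒟 Λ r₀ γ s 𝓢 E p) →
    (∀ (𝓢 : Spacetime.{0} 4) (E : EndDatum 𝓢) (p : 𝓢.carrier), IsHorizonHullElement 𝒟 Λ r₀ γ 𝓢 E p →
      ∃ a : ℝ, Kerr.IsExtremal M' a ∧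
        ∃ Ψ : Kerr.exterior M' a → 𝓢.carrier, Function.Injective Ψ ∧ Set.range Ψ = E.doc ∧
          PseudoRiemannianMetric.IsLocalIsometry
            (Kerr.smoothMetric M' a (Kerr.rPlus M' a)).toPseudoRiemannianMetric
            𝓢.metric.toPseudoRiemannianMetric Ψ) →
    ∃ (L : lorentzGroup) (c : E4) (a : ℝ) (τ₀ : ℝ)
      (Φ : (boostedKerrBackground L c M' a).domain → 𝒟.carrier), Kerr.IsExtremal M' a ∧
      𝒟.toSpacetime.IsLateChart (boostedKerrBackground L c M' a) Set.univ τ₀ Φ ∧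
        ∀ R : ℝ, Tendsto (fun τ ↦ 𝒟.toSpacetime.truncDeviationCk
          (boostedKerrBackground L c M' a) Φ 2 R τ) atTop (𝓝 0)

/-! ### §2 The promotion from the three inputs -/

/-- **Horizon-hull elements along a precompact, pinned, glueable generator are late-charted**: an extremal shadow of
ONE element along `γ` makes all elements along `γ` extremal-shadowed of the same mass (E2), and then (E3) produces the
late chart. [cite: DafermosLuk2017, §1.2.1] -/
theorem lateChartFromHullElement_of_pinning_of_gluing {𝒟 : VacuumCauchyDevelopment D} [𝒟.metric.HasLeviCivita]
    {Λ : ℕ → ℝ≥0} {r₀ : ℝ} {γ : ℝ → 𝒟.carrier}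
    (hprec : ∀ s : ℕ → ℝ, Tendsto s atTop atTop →
      ∃ (𝓢 : Spacetime.{0} 4) (E : EndDatum 𝓢) (p : 𝓢.carrier), IsHorizonHullElementAlong 𝒟 Λ r₀ γ s 𝓢 E p)
    (hpin : ExtremalPinningAlong 𝒟 Λ r₀ γ) (hglue : LateChartOfExtremalGenerator 𝒟 Λ r₀ γ)
    {𝓢 : Spacetime.{0} 4} {E : EndDatum 𝓢} {p : 𝓢.carrier} (hZ : IsHorizonHullElement 𝒟 Λ r₀ γ 𝓢 E p) :
    LateChartFromHullElement 𝒟 𝓢 E := by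
  intro _ M' a hext hΨ
  exact hglue M' hext.2 hprec (hpin M' a hext ⟨𝓢, E, p, hZ, hΨ⟩)

/-- **Outer silent hull elements of a class with rebasing, precompact generator hull, pinning and gluing are
late-charted**: shadow an extremal isometric d.o.c. of mass `M'` on a generator path (E1) — the horizon-based element
found there may be a different end, but the promoted chart only remembers the mass — and apply the previous lemma to
it. [cite: DafermosLuk2017, §1.2.1] -/
theorem lateChartFromHullElement_of_rebase {𝒟 : VacuumCauchyDevelopment D} [𝒟.metric.HasLeviCivita]
    {Λ : ℕ → ℝ≥0} {r₀ : ℝ} (hre : ExtremalOuterRebase 𝒟 Λ r₀) (hgen : GeneratorHullExists 𝒟 Λ r₀)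
    (hpg : ∀ γ : ℝ → 𝒟.carrier, IsHorizonPath 𝒟 γ →
      ExtremalPinningAlong 𝒟 Λ r₀ γ ∧ LateChartOfExtremalGenerator 𝒟 Λ r₀ γ)
    {q : ℕ → 𝒟.carrier} {𝓢 : Spacetime.{0} 4} {E : EndDatum 𝓢} {p : 𝓢.carrier}
    (hZ : IsSilentHullElement 𝒟 Λ r₀ q 𝓢 E p) : LateChartFromHullElement 𝒟 𝓢 E := by
  intro _ M' a hext hΨ
  obtain ⟨γ, s, 𝓢', E', p', a', hγ, hs, hZ', hext', hΨ'⟩ := hre q 𝓢 E p hZ M' a hext hΨ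
  exact lateChartFromHullElement_of_pinning_of_gluing (hgen γ hγ) (hpg γ hγ).1 (hpg γ hγ).2 ⟨s, hs, hZ'⟩
    M' a' hext' hΨ'

/-- **Every silent hull element (outer or horizon-based) of such a class is late-charted.** [cite: DafermosLuk2017, §1.2.1] -/
theorem lateChartFromHullElement_of_inputs {𝒟 : VacuumCauchyDevelopment D} [𝒟.metric.HasLeviCivita]
    {Λ : ℕ → ℝ≥0} {r₀ : ℝ} (hre : ExtremalOuterRebase 𝒟 Λ r₀) (hgen : GeneratorHullExists 𝒟 Λ r₀)
    (hpg : ∀ γ : ℝ → 𝒟.carrier, IsHorizonPath 𝒟 γ →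
      ExtremalPinningAlong 𝒟 Λ r₀ γ ∧ LateChartOfExtremalGenerator 𝒟 Λ r₀ γ)
    {𝓢 : Spacetime.{0} 4} {E : EndDatum 𝓢} {p : 𝓢.carrier}
    (hel : (∃ q : ℕ → 𝒟.carrier, IsSilentHullElement 𝒟 Λ r₀ q 𝓢 E p) ∨
      (∃ (γ : ℝ → 𝒟.carrier) (s : ℕ → ℝ), IsHorizonPath 𝒟 γ ∧ Tendsto s atTop atTop ∧
        IsHorizonHullElementAlong 𝒟 Λ r₀ γ s 𝓢 E p)) : LateChartFromHullElement 𝒟 𝓢 E := by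
  rcases hel with ⟨q, hZ⟩ | ⟨γ, s, hγ, hs, hZ⟩
  · exact lateChartFromHullElement_of_rebase hre hgen hpg hZ
  · exact lateChartFromHullElement_of_pinning_of_gluing (hgen γ hγ) (hpg γ hγ).1 (hpg γ hγ).2 ⟨s, hs, hZ⟩

end Development

/-! ### §3 N at every class with `0 < r₀` and a precompact generator hull, from (i) and (E1)–(E3) -/

/-- **Stub N at every class carrying a precompact generator hull, from rebasing, pinning and gluing (registered
sub-goal `noExtremalShadow_ofClass_of_rebase_of_pinning_of_gluing` of stmt-FinalStateConjecture-17430).** Hypothesis: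
for every development as in Φ and every class `(Λ, r₀)` with `0 < r₀` and `GeneratorHullExists 𝒟 Λ r₀` (clause (b) of
A′): (E1) `ExtremalOuterRebase` (outer extremal shadows are shadowed on the horizon), and along every horizon generator path (E2) `ExtremalPinningAlong` and (E3)
`LateChartOfExtremalGenerator`. Conclusion: the registered text of N with the two hypotheses `0 < r₀`,
`GeneratorHullExists 𝒟 Λ r₀` inserted after the class binders — exactly what the line's composition consumes (N is
applied only at A′'s class). Proof: every silent hull element of such a class is late-charted
(`lateChartFromHullElement_of_inputs`), and (i) `DevHyp.noRemnant` forbids the promoted chart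
(`abs_lt_of_lateChartFromHullElement`). [cite: DafermosLuk2017, §1.2.1] -/
theorem noExtremalShadow_ofClass_of_rebase_of_pinning_of_gluing : (∀ {X : Type} [TopologicalSpace X] [ChartedSpace E3 X] [IsManifold (𝓡 3) ∞ X] [T2Space X] [SecondCountableTopology X] [ConnectedSpace X] {D : InitialDataSet (𝓡 3) X}, D ∈ admissibleVacuumData X → ∀ (𝒟 : VacuumCauchyDevelopment D) [𝒟.metric.HasLeviCivita], DevHyp 𝒟 → ∀ (Λ : ℕ → ℝ≥0) (r₀ : ℝ), 0 < r₀ → GeneratorHullExists 𝒟 Λ r₀ → ExtremalOuterRebase 𝒟 Λ r₀ ∧ ∀ γ : ℝ → 𝒟.carrier, IsHorizonPath 𝒟 γ → ExtremalPinningAlong 𝒟 Λ r₀ γ ∧ LateChartOfExtremalGenerator 𝒟 Λ r₀ γ) → ∀ (X : Type) [TopologicalSpace X] [ChartedSpace E3 X] [IsManifold (𝓡 3) ∞ X] [T2Space X] [SecondCountableTopology X] [ConnectedSpace X], ∀ D ∈ admissibleVacuumData X, ∀ (𝒟 : VacuumCauchyDevelopment D) [𝒟.metric.HasLeviCivita],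 DevHyp 𝒟 → ∀ (Λ : ℕ → ℝ≥0) (r₀ : ℝ), 0 < r₀ → GeneratorHullExists 𝒟 Λ r₀ → ∀ (𝓢 : Spacetime.{0} 4) (E : EndDatum 𝓢) (p : 𝓢.carrier), ((∃ q : ℕ → 𝒟.carrier, IsSilentHullElement 𝒟 Λ r₀ q 𝓢 E p) ∨ (∃ (γ : ℝ → 𝒟.carrier) (s : ℕ → ℝ), IsHorizonPath 𝒟 γ ∧ Tendsto s atTop atTop ∧ IsHorizonHullElementAlong 𝒟 Λ r₀ γ s 𝓢 E p)) → ∀ [Kerr.Facts], ∀ M' a : ℝ, 0 < M' → |a| ≤ M' → (∃ Ψ : Kerr.exterior M' a → 𝓢.carrier, Function.Injective Ψ ∧ Set.range Ψ = E.doc ∧ PseudoRiemannianMetric.IsLocalIsometry (Kerr.smoothMetric M' a (Kerr.rPlus M' a)).toPseudoRiemannianMetric 𝓢.metric.toPseudoRiemannianMetric Ψ) → |a| < M' := by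
  intro H X _ _ _ _ _ _ D hD 𝒟 _ hdev Λ r₀ hr₀ hgen 𝓢 E p hel _ M' a hM' ha hΨ
  obtain ⟨hre, hpg⟩ := H hD 𝒟 hdev Λ r₀ hr₀ hgen
  exact abs_lt_of_lateChartFromHullElement hdev.noRemnant (lateChartFromHullElement_of_inputs hre hgen hpg hel) hM' ha hΨ

/-- **The same inputs at EVERY class give N verbatim when every class of every development as in Φ has `0 < r₀` and a
precompact generator hull** — recorded only to make the gap between N and its class-restricted form explicit: the
extra hypothesis is false in general (N quantifies over arbitrary `(Λ, r₀)`), so N for all classes needs either (E3)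
without precompactness or a transfer of shadows between classes; the honest statement is the previous theorem.
[cite: DafermosLuk2017, §1.2.1] -/
theorem noExtremalShadow_of_inputs_of_forall_generatorHullExists : (∀ {X : Type} [TopologicalSpace X] [ChartedSpace E3 X] [IsManifold (𝓡 3) ∞ X] [T2Space X] [SecondCountableTopology X] [ConnectedSpace X] {D : InitialDataSet (𝓡 3) X}, D ∈ admissibleVacuumData X → ∀ (𝒟 : VacuumCauchyDevelopment D) [𝒟.metric.HasLeviCivita], DevHyp 𝒟 → ∀ (Λ : ℕ → ℝ≥0) (r₀ : ℝ), GeneratorHullExists 𝒟 Λ r₀ ∧ ExtremalOuterRebase 𝒟 Λ r₀ ∧ ∀ γ : ℝ → 𝒟.carrier, IsHorizonPath 𝒟 γ → ExtremalPinningAlong 𝒟 Λ r₀ γ ∧ LateChartOfExtremalGenerator 𝒟 Λ r₀ γ) → ∀ (X : Type) [TopologicalSpace X] [ChartedSpace E3 X] [IsManifold (𝓡 3) ∞ X] [T2Space X] [SecondCountableTopology X] [ConnectedSpace X], ∀ D ∈ admissibleVacuumData X, ∀ (𝒟 : VacuumCauchyDevelopment D) [𝒟.metric.HasLeviCivita],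 DevHyp 𝒟 → ∀ (Λ : ℕ → ℝ≥0) (r₀ : ℝ) (𝓢 : Spacetime.{0} 4) (E : EndDatum 𝓢) (p : 𝓢.carrier), ((∃ q : ℕ → 𝒟.carrier, IsSilentHullElement 𝒟 Λ r₀ q 𝓢 E p) ∨ (∃ (γ : ℝ → 𝒟.carrier) (s : ℕ → ℝ), IsHorizonPath 𝒟 γ ∧ Tendsto s atTop atTop ∧ IsHorizonHullElementAlong 𝒟 Λ r₀ γ s 𝓢 E p)) → ∀ [Kerr.Facts], ∀ M' a : ℝ, 0 < M' → |a| ≤ M' → (∃ Ψ : Kerr.exterior M' a → 𝓢.carrier, Function.Injective Ψ ∧ Set.range Ψ = E.doc ∧ PseudoRiemannianMetric.IsLocalIsometry (Kerr.smoothMetric M' a (Kerr.rPlus M' a)).toPseudoRiemannianMetric 𝓢.metric.toPseudoRiemannianMetric Ψ) → |a| < M' := by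
  refine fun H ↦ noExtremalShadow_of_lateChartFromHullElement fun hD 𝒟 _ hdev Λ r₀ 𝓢 E p hel ↦ ?_
  obtain ⟨hgen, hre, hpg⟩ := H hD 𝒟 hdev Λ r₀
  exact lateChartFromHullElement_of_inputs hre hgen hpg hel

end Summit.FinalStateConjecture.FinalStateConjecture.Theorems.TameLaSalle

end
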